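import Summits.AtomisticToContinuum.Crystallization.Theorems.OverbindingBudgetAffineMesoCutA

/-!
# Overbinding budget — «MesoCut»: the affine MID census M cut at ONE MESOSCOPIC TOLERANCE (decomp-a2c lens-4, generation 74)

Child of `…Theorems.OverbindingBudgetAffineNearCollarCut` (lens-4 g73, critic row 1299 CLEARED · ADMITTED; slot-3 cone of record
`tbdsg_of_collarCut_record : K_at⁰ ∧ R_aff ∧ CP⁺ ∧ RC ∧ RS ∧ FC ∧ N2 ∧ Z ∧ M ⟹ TameBalancedDeepScaleGap (122/125) 0 4 (3/50) (1/450)`).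
Part B (thesis · seam · normal form · record cones) of a two-part node; part A = `…Theorems.OverbindingBudgetAffineMesoCutA` (counts, the FR
statements, shadow packing).  Memo: `HOME/decomp-a2c-lens-4/g74/memo/NODE-g74-MesoCut.md`.  Probes: `HOME/…/g74/bc/probes_meso.lean`, `bc7_meso.lean`.

## Target and why this leaf
M `= AffMidAll 12 (1/25) = ∀ ε₁ > 0, TameBalancedAffMidGap 4 12 ε₁ (1/25) (3/50) (1/450)` (g43 `…AffineLadder`): the aggregate pricing of the
affine MID sites — `(4, 3/50)`-deeply registered sites with a site within `12·nn` that is NOT affinely `(ε₁, 1/25)`-registered — at EVERY fine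
tolerance `ε₁`, against the rebates `#¬deep + #off + N^{2/3} + gains`.  M is the one leaf of the slot-3 cone tagged IDEA-NEEDED since g43 and never
decomposed (g44–g73 cut the affinely registered side: N2, Z, the near skeleton floors).  RESIDUAL-MODE doctrine: decompose / reformulate the
IDEA-NEEDED piece, do not polish side leaves (RC/RS paper cuts are critic-sequenced behind census ⑨/⑨b/⑨d, row 1299 (2)).

## Lens-4 reading (minimal counterexample / extremal reduction) and the node
Failure of `MID_aff(ε₁)` is MONOTONE in the tolerance: `ε ≤ ε' ⇒ #MID_aff(ε') ≤ #MID_aff(ε)` (`affMidCount_anti_tol`), so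
`MID_aff(ε) ⇒ MID_aff(ε')` (`balancedAffMidGapW_mono_tol`) — the set of tolerances at which aggregate pricing holds is an UP-SET.  The extremal
question «what is the LEAST tolerance scale at which a counterexample family lives?» has exactly two answers, and they are two different theorems:
* **MR** («mesoscopic roughness is priced») `:= TameBalancedAffMidGap L 12 ε_h (1/25) (3/50) (1/450)` — the TREE statement at ONE finite
  tolerance `ε_h` (record `ε_h = 1/10⁵`, pricing depth `L = 64`).  [tree decl instance · route statement of this cell · UNDECIDED ·
  IDEA-NEEDED (the non-perturbative kernel of M) · INSTRUMENTABLE (census ⑩ below) · WEAKER: `M ⇒ MR` PROVED (`meso_of_affMidAll`), `MR ⇏ M`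
  (probes P1/P1′; MR is silent on every site whose `12`-environment is `10⁻⁵`-affine)].  Its minimal counterexamples are, by the PROVED
  L-CLEAN NORMAL FORM (§5: pricing depth `64` ⟺ depth `4` modulo constants, `tameBalancedAffMidGap_of_depth` / `…_depth_mono`, a shape-free
  packing theorem `notDeepCount_depth_le`), families of configurations whose priced sites see NO unregistered / charged site within `64·nn`,
  whose excess energy per priced site → 0 and whose defect count per priced site → 0: DEFECT-FREE, `6%`-registered, energetically optimal but
  `10⁻⁵`-ROUGH-at-scale-12 crystals.  MR says they do not exist: an ENERGY-RIGIDITY (Liouville-type) statement for registered Lennard-Jones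
  matter at a FIXED roughness threshold — no `ε₁ → 0` asymptotics, no `ε₁`-dependent constants.
* **FR** («fine non-affinity is priced in the harmonic regime») `:= FineNonAffinity 12 ε_h (1/25)` (NEW, §3): for every `0 < ε₁ ≤ ε_h`, the FINE
  LAYER — sites that are `(4,3/50)`-deep AND affinely `(12, ε_h, 1/25)`-deep but NOT affinely `(12, ε₁, 1/25)`-deep — is priced at `c(ε₁) > 0`
  per site against the rebate of EVERY site that is not mesoscopically good (`mesoBadCount`: not deep or not `ε_h`-affinely deep; in
  particular all of MR's priced matter is REBATED here).  [NEW · route statement of this cell · UNDECIDED · ATTACKABLE-L · TRUE-type on paper ·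
  WEAKER: `M ⇒ FR` PROVED (`fineNonAffinity_of_affMidAll`), `FR ⇏ M` (probes P2/P2′; FR is silent on rough matter)].  Every priced site carries
  a whole `12·nn`-ball that is sitewise `10⁻⁵`-affine: the regime of the second-order (harmonic) expansion about the two-shell patterns, where
  non-affinity `≥ ε₁·nn` over the ball forces strain `≳ ε₁/ρ₁` at some site (discrete Poincaré) hence, by discrete geometric rigidity
  (Friesecke–James–Müller; cell rigidity `dist²(F, SO(3)H) ≤ C·E_cell`, arXiv:1601.05968 Thm 1.1 + Lemma p. 32) and lattice stability
  (`λ_min(T_d) = 4`, g42 `…LocalHarmonicCertificate`; Cauchy–Born stability à la E–Ming 2007), excess `≳ κ ε₁²/ρ₁²` per ball, while the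
  strain-GRADIENT corrections to the sitewise Cauchy–Born energies are `O(|∇²u|²) = O((non-affinity/ρ₁²)²)`.  WHY IT MIGHT FAIL (one line): the
  constant competition `κ_stab · c_rigidity · ρ₁² ≳ C_∇²` at `ρ₁ = 12` — second-gradient (bending) corrections can make registered site energies
  dip below `e⋆` at second order, the same order as the rigidity gain unless the scale factor `ρ₁² = 144` wins; constants uncomputed.
* **SEAM (PROVED, 0 sorry)**: `MR ∧ FR ⇒ M` — below `ε_h` by the cut seam `balancedAffMidGapW_of_meso_layer` (`#MID_aff(ε₁) ≤ #MID_aff(ε_h) +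
  #fineLayer`, `#¬meso-good ≤ #¬deep + #MID_aff(ε_h)`: FR plays the fine leaf and MR the mid leaf of g41's `convexComb_core`, BY NAME), at and
  above `ε_h` by monotonicity; `affMidAll_of_mesoCut`, record `affMidAll_record_of_mesoCut` (depth `64 → 4` by the normal form), slot-3 cone
  `tbdsg_of_mesoCut_record : K_at⁰ ∧ R_aff ∧ CP⁺ ∧ RC ∧ RS ∧ FC ∧ N2 ∧ Z ∧ MR ∧ FR ⟹ TBDSG_rec` through g73's `tbdsg_of_collarCut_record`, and the
  RDEF shape `rdef_of_ceg_shape_mesoCut_record`.  Converse kernel directions PROVED (`mesoCut_record_of_affMidAll`): the cut loses nothing.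

## Why each piece is STRICTLY WEAKER than M, and not a rewording
MR is M at one tolerance out of all (M quantifies `∀ ε₁ > 0` with `ε₁`-dependent constants; MR fixes `ε₁ = 10⁻⁵`): it asserts nothing about
the fine layers `ε₁ < 10⁻⁵`, which M prices.  FR rebates (at an arbitrary constant) every site that MR prices, so it asserts nothing about
rough matter, which M prices.  Neither implies the other (P3/P4: disjoint priced classes, each rebating what the other prices).  The word test:
MR = «registered LJ matter that is rough at scale 12 above a FIXED threshold pays linearly» (non-perturbative, threshold-free of `ε₁ → 0`);
FR = «inside mesoscopically affine matter, finer non-affinity pays quadratically» (perturbative); M = both at once with one set of constants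
per `ε₁`.  Record literals: `ε_h = 10⁻⁵` is the largest tolerance at which the harmonic Taylor regime over radius `12` is certified by the
tree's R_aff hypothesis shape (`C·144·ε_h ≤ 1/100` for `C ≤ 7`); `L = 64` is any depth `≥ 4` (normal form) chosen so that a priced site's
`12`-ball AND its `2·12`-collar AND the LJ tail range are defect-free; ONE affine radius `ρ₁ = 12` for both tolerances (a smaller mesoscopic
radius breaks `M ⇒ MR`, a larger one breaks the counting inclusion `fineLayer ⊆ MID_aff(ε₁)`).

## Why novel (relative to the tree and the cell)
(i) The first cut of the DEEP census BY A SECOND TOLERANCE SCALE: g43 cut `TBDSG` by registration QUALITY at the running tolerance (affine-fine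
vs affine-mid), g47 by LOCALISATION, g44–g73 by near/far STRAIN class and skeleton SURFACES — all on the affinely registered side; nobody cut M,
and no tree statement separates a fixed-threshold kernel from the `ε₁ → 0` layer-cake.  (ii) The L-clean normal form is a THEOREM (§5), not a
modelling assumption: «the minimal counterexample to MID pricing is defect-free out to any fixed radius» is now `tameBalancedAffMidGap_of_depth`,
available to every later seat on M or MR (and, verbatim, to the similarity-frame census `BalancedDeepScaleGapW`).  (iii) FR isolates the part of
M that the literature's discrete-rigidity / Cauchy–Born machinery (FJM 2002; Schmidt, Braides–Solci–Vitali, Alicandro–Lazzaroni–Palombaro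
arXiv:1601.05968; E–Ming 2007; Flatley–Theil arXiv:1407.0692 §rigidity for localised potentials) can plausibly reach for Lennard-Jones, and
names the one constant competition that decides it.

## Census ask ⑩ «meso-roughness» (LOW; instruments MR, cheap)
L-clean texture zoo at the record (`L = 64`, `ρ₁ = 12`, `ε_h = 10⁻⁵`, `θ = 1/25`, frame `(4, 3/50, 1/450)`): relaxed long-period / faulted
close-packed polytypes, coherent twins, defect-free slabs bent or twisted to curvature radii `10³–10⁷ nn`, frozen phonon fields of amplitude
`10⁻⁴–10⁻²`, uniformly `4–6 %`-strained registered crystals; report `#MID_aff(64 → 12, 10⁻⁵, 1/25)` against `(𝓔 − N e⋆) + #¬deep₆₄ + #off +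
N^{2/3}`; PASS if the ratio stays bounded (MR TRUE-type), FAIL names the Liouville counterexample family (and refutes M itself, hence the cone).

## Dead ends booked this generation (memo §6)
sitewise antisymmetric bond-flux calibration of first-order site-energy variation (weights forced constant along bond lines: no local solution);
moving fine roughness into the near machinery (chart-transition fluxes `O(ε_h)` per bond ≫ `κ ≈ 10⁻⁷` budgets); iterating the cut upward
(`ε_h → 10 ε_h …`: Taylor validity caps it near `10⁻⁴`, the kernel `MR` is irreducibly non-perturbative); a mesoscopic distortion bound
`θ_h < 1/25` or radius `ρ_h ≠ 12` (breaks `M ⇒ MR` or the counting inclusion); compactness-contradiction for MR without a localisation of excess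
(stays IDEA-NEEDED).

sorry-free · Mathlib + tree only · no new axioms · no instance / notation beyond the tree's file-local `E3` · every seam by NAME
(`convexComb_core`, `card_le_of_cube`, `deepReg_anti`, `notDeepCount_mono`, `tbdsg_of_collarCut_record`, `rdef_of_ceg_shape_collarCut_record`).
-/

namespace Summit.AtomisticToContinuum.Crystallization.Theorems.OverbindingBudgetAffineMesoCut

open scoped BigOperators Classical
open Literature.MathematicalPhysics.StatisticalMechanics
open Literature.Geometry.DiscreteGeometry (IsChargeFree nearestDist nearestDist_nonneg nearestDist_le_dist)
open Summit.AtomisticToContinuum.Crystallization.Theses.OverbindingBudget (RobustDefectLimitWindows)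
open Summit.AtomisticToContinuum.Crystallization.Theses.PricedLinkCensus (ChargedEnergyGap)
open Summit.AtomisticToContinuum.Crystallization.Theorems.OverbindingBudgetGradedBareness (CleanlessExcessT)
open Summit.AtomisticToContinuum.Crystallization.Theorems.OverbindingBudgetCoherentCut (CoherentResidual)
open Summit.AtomisticToContinuum.Crystallization.Theorems.OverbindingBudgetTwoShellShape (TwoShellShape)
open Summit.AtomisticToContinuum.Crystallization.Theorems.OverbindingBudgetMisfitCensusStatements (card_le_of_cube)
open Summit.AtomisticToContinuum.Crystallization.Theorems.OverbindingBudgetMisfitRegistration (Framed Reg DeepReg)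
open Summit.AtomisticToContinuum.Crystallization.Theorems.OverbindingBudgetMisfitWindowStatements (InWindow offCount)
open Summit.AtomisticToContinuum.Crystallization.Theorems.OverbindingBudgetBalancedCensusStatements
open Summit.AtomisticToContinuum.Crystallization.Theorems.OverbindingBudgetBalancedCensusRecord
open Summit.AtomisticToContinuum.Crystallization.Theorems.OverbindingBudgetHarmonicNormalForm
open Summit.AtomisticToContinuum.Crystallization.Theorems.OverbindingBudgetLocalHarmonicCertificate
open Summit.AtomisticToContinuum.Crystallization.Theorems.OverbindingBudgetAffineLadder
open Summit.AtomisticToContinuum.Crystallization.Theorems.OverbindingBudgetAffineLocalisation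
open Summit.AtomisticToContinuum.Crystallization.Theorems.OverbindingBudgetAffineNearCluster

variable {N : ℕ}

local notation "E3" => EuclideanSpace ℝ (Fin 3)

/-! ## §4  THE TOLERANCE CUT SEAM (PROVED): MID_aff(ε_h) ∧ FR(ε_h, ε₁) ⇒ MID_aff(ε₁); MID_aff(ε_h) ⇒ MID_aff(ε₁) for ε₁ ≥ ε_h -/

/-- **The cut seam at one window, one fine tolerance**: `MID_aff,W(ε_h) ∧ FR_W(ε_h, ε₁) ⇒ MID_aff,W(ε₁)`.  Arithmetic = g41's
`convexComb_core` BY NAME (FR plays the fine leaf: it prices the layer and rebates `¬meso-good ⊆ ¬deep ∪ MID_aff(ε_h)`; MID_aff(ε_h) prices the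
latter); the shear direction is the one of larger gain. [this file] -/
theorem balancedAffMidGapW_of_meso_layer {ρ ρ₁ εh ε₁ θ ε g σ₁ σ₂ : ℝ}
    (hM : BalancedAffMidGapW ρ ρ₁ εh θ ε g σ₁ σ₂) (hF : BalancedFineLayerGapW ρ ρ₁ εh ε₁ θ ε g σ₁ σ₂) :
    BalancedAffMidGapW ρ ρ₁ ε₁ θ ε g σ₁ σ₂ := by
  obtain ⟨c₁, C₁, hc₁, h₁⟩ := hF
  obtain ⟨c₂, C₂, hc₂, h₂⟩ := hM
  have hP₁0 : 0 ≤ max C₁ 0 := le_max_right _ _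
  have hK : 0 < max C₁ 0 + c₂ + 1 := by linarith
  set t : ℝ := c₂ / (4 * (max C₁ 0 + c₂ + 1)) with ht
  have ht0 : 0 < t := by rw [ht]; positivity
  have ht4 : t ≤ 1 / 4 := by
    rw [ht, div_le_iff₀ (by positivity)]
    nlinarith
  have htP : t * max C₁ 0 ≤ c₂ / 4 := by
    rw [ht, div_mul_eq_mul_div, div_le_iff₀ (by positivity)]
    nlinarith [mul_nonneg hc₂.le hP₁0, mul_nonneg hc₂.le hc₂.le]
  set m : ℝ := min (t * c₁) (c₂ / 4) with hm
  have hm0 : 0 < m := lt_min (mul_pos ht0 hc₁) (by positivity)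
  refine ⟨m, max C₁ 0 + max C₂ 0, hm0, fun N y hy => ?_⟩
  obtain ⟨u₁, hu₁, H₁⟩ := h₁ N y hy
  obtain ⟨u₂, hu₂, H₂⟩ := h₂ N y hy
  have hRc : (affMidCount ρ ρ₁ ε₁ θ ε g y : ℝ) ≤ fineLayerCount ρ ρ₁ εh ε₁ θ ε g y + affMidCount ρ ρ₁ εh θ ε g y := by
    have := affMidCount_le_meso_add_layer (ρ := ρ) (ρ₁ := ρ₁) (εh := εh) (ε₁ := ε₁) (θ := θ) (ε := ε) (g := g) y
    push_cast [add_comm] at this ⊢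
    exact_mod_cast (by omega)
  have hDc : (mesoBadCount ρ ρ₁ εh θ ε g y : ℝ) ≤ notDeepCount ρ ε g y + affMidCount ρ ρ₁ εh θ ε g y := by
    exact_mod_cast mesoBadCount_le_notDeep_add_affMid y
  have n1 : (0 : ℝ) ≤ fineLayerCount ρ ρ₁ εh ε₁ θ ε g y := Nat.cast_nonneg _
  have n2 : (0 : ℝ) ≤ affMidCount ρ ρ₁ εh θ ε g y := Nat.cast_nonneg _
  have n3 : (0 : ℝ) ≤ notDeepCount ρ ε g y := Nat.cast_nonneg _
  have n4 : (0 : ℝ) ≤ mesoBadCount ρ ρ₁ εh θ ε g y := Nat.cast_nonneg _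
  have n5 : (0 : ℝ) ≤ offCount σ₁ σ₂ y := Nat.cast_nonneg _
  have n6 : (0 : ℝ) ≤ (N : ℝ) ^ (2 / 3 : ℝ) := Real.rpow_nonneg (Nat.cast_nonneg _) _
  have g1 : 0 ≤ dilGain y + shGain u₁ y := add_nonneg (dilGain_nonneg y) (shGain_nonneg _ y)
  have g2 : 0 ≤ dilGain y + shGain u₂ y := add_nonneg (dilGain_nonneg y) (shGain_nonneg _ y)
  rcases le_total (shGain u₁ y) (shGain u₂ y) with hle | hle
  · refine ⟨u₂, hu₂, ?_⟩
    exact convexComb_core H₁ H₂ hRc hDc n1 n2 n3 n4 n5 n6 g1 g2 (by linarith) le_rfl hc₂ ht0 ht4 htP hm0.le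
      (min_le_left _ _) (min_le_right _ _)
  · refine ⟨u₁, hu₁, ?_⟩
    exact convexComb_core H₁ H₂ hRc hDc n1 n2 n3 n4 n5 n6 g1 g2 le_rfl (by linarith) hc₂ ht0 ht4 htP hm0.le
      (min_le_left _ _) (min_le_right _ _)

/-- **Tolerance monotonicity of MID_aff,W**: `ε_h ≤ ε₁ ⇒ MID_aff,W(ε_h) ⇒ MID_aff,W(ε₁)` (fewer sites priced, same constants). [this file] -/
theorem balancedAffMidGapW_mono_tol {ρ ρ₁ εh ε₁ θ ε g σ₁ σ₂ : ℝ} (hε : εh ≤ ε₁) (h : BalancedAffMidGapW ρ ρ₁ εh θ ε g σ₁ σ₂) :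
    BalancedAffMidGapW ρ ρ₁ ε₁ θ ε g σ₁ σ₂ := by
  obtain ⟨c, C, hc, h⟩ := h
  refine ⟨c, C, hc, fun N y hy => ?_⟩
  obtain ⟨u, hu, e⟩ := h N y hy
  refine ⟨u, hu, ?_⟩
  have h1 : (affMidCount ρ ρ₁ ε₁ θ ε g y : ℝ) ≤ affMidCount ρ ρ₁ εh θ ε g y := by exact_mod_cast affMidCount_anti_tol hε y
  nlinarith [mul_le_mul_of_nonneg_left h1 hc.le]

/-- **THE CUT (tame form; the AND-node of this file).**  `MID_aff(4 → ρ₁, ε_h, θ) ∧ FR(ρ₁, ε_h, θ) ⇒ AffMidAll ρ₁ θ`: below `ε_h` by the cut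
seam, at and above `ε_h` by tolerance monotonicity. [this file] -/
theorem affMidAll_of_mesoCut {ρ₁ εh θ : ℝ} (hM : TameBalancedAffMidGap 4 ρ₁ εh θ (3 / 50) (1 / 450)) (hF : FineNonAffinity ρ₁ εh θ) :
    AffMidAll ρ₁ θ := by
  intro ε₁ hε₁ δ hδ hδ2
  rcases le_or_gt ε₁ εh with h | h
  · exact balancedAffMidGapW_of_meso_layer (hM δ hδ hδ2) (hF ε₁ hε₁ h δ hδ hδ2)
  · exact balancedAffMidGapW_mono_tol h.le (hM δ hδ hδ2)

/-! ## §5b  THE L-CLEAN NORMAL FORM, energy half (PROVED): pricing depth `L` ⟺ pricing depth `ρ` modulo constants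

Part A's `notDeepCount_depth_le` charges the `L`-shadow of the defects to the `ρ`-rebate; here the census constants absorb it. -/

/-- **Normal form, hard direction (PROVED)**: pricing at depth `L` implies pricing at depth `ρ` — `MID_aff,W(L → ρ₁) ⇒ MID_aff,W(ρ → ρ₁)` for all
`ρ, L ≥ 0` on a window `0 < σ₁ ≤ σ₂` (the `L`-shadow of the defects is count-charged to the `ρ`-rebate by packing). [this file] -/
theorem balancedAffMidGapW_of_depth {ρ L ρ₁ ε₁ θ ε g σ₁ σ₂ : ℝ} (hρ : 0 ≤ ρ) (hL : 0 ≤ L) (hσ : 0 < σ₁) (hσσ : σ₁ ≤ σ₂)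
    (h : BalancedAffMidGapW L ρ₁ ε₁ θ ε g σ₁ σ₂) : BalancedAffMidGapW ρ ρ₁ ε₁ θ ε g σ₁ σ₂ := by
  obtain ⟨c, C, hc, h⟩ := h
  set K : ℝ := 27 / σ₁ ^ 3 * (2 * L * σ₂ + σ₁) ^ 3 with hK
  have hb : 0 ≤ 2 * L * σ₂ + σ₁ := by nlinarith [mul_nonneg hL (hσ.le.trans hσσ)]
  have hK0 : 0 ≤ K := by rw [hK]; exact mul_nonneg (div_nonneg (by norm_num) (pow_nonneg hσ.le 3)) (pow_nonneg hb 3)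
  set P : ℝ := max C 0 with hP
  have hP0 : 0 ≤ P := le_max_right _ _
  have hCP : C ≤ P := le_max_left _ _
  refine ⟨c, (c + P) * (K + 1) + P, hc, fun N y hy => ?_⟩
  obtain ⟨u, hu, e⟩ := h N y hy
  refine ⟨u, hu, ?_⟩
  have ha : (affMidCount ρ ρ₁ ε₁ θ ε g y : ℝ) ≤ affMidCount L ρ₁ ε₁ θ ε g y + notDeepCount L ε g y := by
    exact_mod_cast affMidCount_depth_le y
  have hd : (notDeepCount L ε g y : ℝ) ≤ K * notDeepCount ρ ε g y + offCount σ₁ σ₂ y := by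
    rw [hK]; exact notDeepCount_depth_le hρ hL hσ hσσ hy
  have n1 : (0 : ℝ) ≤ affMidCount L ρ₁ ε₁ θ ε g y := Nat.cast_nonneg _
  have n2 : (0 : ℝ) ≤ notDeepCount L ε g y := Nat.cast_nonneg _
  have n3 : (0 : ℝ) ≤ notDeepCount ρ ε g y := Nat.cast_nonneg _
  have n5 : (0 : ℝ) ≤ offCount σ₁ σ₂ y := Nat.cast_nonneg _
  have n6 : (0 : ℝ) ≤ (N : ℝ) ^ (2 / 3 : ℝ) := Real.rpow_nonneg (Nat.cast_nonneg _) _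
  have g1 : 0 ≤ dilGain y + shGain u y := add_nonneg (dilGain_nonneg y) (shGain_nonneg _ y)
  -- upgrade the hypothesis to the nonnegative constant `P`
  have e' : (N : ℝ) * (⨅ Q : PeriodicConfiguration 3, Q.energyPerParticle lennardJones) + c * (affMidCount L ρ₁ ε₁ θ ε g y : ℝ)
      - P * (notDeepCount L ε g y : ℝ) - P * (offCount σ₁ σ₂ y : ℝ) - P * (N : ℝ) ^ (2 / 3 : ℝ) - P * (dilGain y + shGain u y)
      ≤ interactionEnergy lennardJones y := by
    linarith [mul_le_mul_of_nonneg_right hCP n2, mul_le_mul_of_nonneg_right hCP n5, mul_le_mul_of_nonneg_right hCP n6,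
      mul_le_mul_of_nonneg_right hCP g1]
  have hcP : 0 ≤ c + P := by linarith
  have step1 : c * (affMidCount ρ ρ₁ ε₁ θ ε g y : ℝ) ≤ c * affMidCount L ρ₁ ε₁ θ ε g y + c * notDeepCount L ε g y := by
    have := mul_le_mul_of_nonneg_left ha hc.le
    linarith
  have step2 : (c + P) * (notDeepCount L ε g y : ℝ) ≤ (c + P) * K * notDeepCount ρ ε g y + (c + P) * offCount σ₁ σ₂ y := by
    have := mul_le_mul_of_nonneg_left hd hcP
    linarith
  linarith [mul_nonneg hcP n3, mul_nonneg hP0 n3, mul_nonneg (mul_nonneg hcP hK0) n5, mul_nonneg (mul_nonneg hcP hK0) n6,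
    mul_nonneg hcP n6, mul_nonneg (mul_nonneg hcP hK0) g1, mul_nonneg hcP g1]

/-- **Normal form, easy direction (PROVED)**: `ρ ≤ L ⇒ MID_aff,W(ρ → ρ₁) ⇒ MID_aff,W(L → ρ₁)` (fewer priced, more rebated). [this file] -/
theorem balancedAffMidGapW_depth_mono {ρ L ρ₁ ε₁ θ ε g σ₁ σ₂ : ℝ} (hρL : ρ ≤ L) (h : BalancedAffMidGapW ρ ρ₁ ε₁ θ ε g σ₁ σ₂) :
    BalancedAffMidGapW L ρ₁ ε₁ θ ε g σ₁ σ₂ := by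
  obtain ⟨c, C, hc, h⟩ := h
  refine ⟨c, max C 0, hc, fun N y hy => ?_⟩
  obtain ⟨u, hu, e⟩ := h N y hy
  refine ⟨u, hu, ?_⟩
  have hC : C ≤ max C 0 := le_max_left _ _
  have hC0 : 0 ≤ max C 0 := le_max_right _ _
  have h0 : (affMidCount L ρ₁ ε₁ θ ε g y : ℝ) ≤ affMidCount ρ ρ₁ ε₁ θ ε g y := by
    have : affMidCount L ρ₁ ε₁ θ ε g y ≤ affMidCount ρ ρ₁ ε₁ θ ε g y := by
      simp only [affMidCount, Nat.card_eq_fintype_card, Fintype.card_subtype]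
      apply Finset.card_le_card
      intro i hi
      rw [Finset.mem_filter] at hi ⊢
      exact ⟨hi.1, deepReg_anti hρL hi.2.1, hi.2.2⟩
    exact_mod_cast this
  have h1 : (0 : ℝ) ≤ notDeepCount ρ ε g y := Nat.cast_nonneg _
  have h1' : (notDeepCount ρ ε g y : ℝ) ≤ notDeepCount L ε g y := by exact_mod_cast notDeepCount_mono hρL y
  have h2 : (0 : ℝ) ≤ offCount σ₁ σ₂ y := Nat.cast_nonneg _
  have h3 : (0 : ℝ) ≤ (N : ℝ) ^ (2 / 3 : ℝ) := Real.rpow_nonneg (Nat.cast_nonneg _) _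
  have h4 : 0 ≤ dilGain y + shGain u y := add_nonneg (dilGain_nonneg y) (shGain_nonneg _ y)
  nlinarith [mul_le_mul_of_nonneg_right hC h1, mul_le_mul_of_nonneg_left h1' hC0, mul_le_mul_of_nonneg_left h0 hc.le,
    mul_le_mul_of_nonneg_right hC h2, mul_le_mul_of_nonneg_right hC h3, mul_le_mul_of_nonneg_right hC h4]

/-- **L-clean normal form (tame)**: for all `ρ, L ≥ 0`, `TameBalancedAffMidGap L ρ₁ ε₁ θ ε g ⇒ TameBalancedAffMidGap ρ ρ₁ ε₁ θ ε g`. [this file] -/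
theorem tameBalancedAffMidGap_of_depth {ρ L ρ₁ ε₁ θ ε g : ℝ} (hρ : 0 ≤ ρ) (hL : 0 ≤ L) (h : TameBalancedAffMidGap L ρ₁ ε₁ θ ε g) :
    TameBalancedAffMidGap ρ ρ₁ ε₁ θ ε g :=
  fun δ hδ hδ2 => balancedAffMidGapW_of_depth hρ hL hδ hδ2 (h δ hδ hδ2)

/-- **L-clean normal form (tame, converse)**: `ρ ≤ L ⇒ TameBalancedAffMidGap ρ … ⇒ TameBalancedAffMidGap L …`. [this file] -/
theorem tameBalancedAffMidGap_depth_mono {ρ L ρ₁ ε₁ θ ε g : ℝ} (hρL : ρ ≤ L) (h : TameBalancedAffMidGap ρ ρ₁ ε₁ θ ε g) :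
    TameBalancedAffMidGap L ρ₁ ε₁ θ ε g :=
  fun δ hδ hδ2 => balancedAffMidGapW_depth_mono hρL (h δ hδ hδ2)

/-! ## §6  BOTH PIECES ARE ON THE WEAKER SIDE OF THE PARENT (PROVED kernel directions; the converses fail the probe battery) -/

/-- MR ⇐ parent: `AffMidAll ρ₁ θ ⇒ TameBalancedAffMidGap L ρ₁ ε_h θ (3/50) (1/450)` for every `ε_h > 0`, `L ≥ 4` (instance + depth monotonicity).
[this file] -/
theorem meso_of_affMidAll {ρ₁ εh θ L : ℝ} (hε : 0 < εh) (hL : 4 ≤ L) (h : AffMidAll ρ₁ θ) :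
    TameBalancedAffMidGap L ρ₁ εh θ (3 / 50) (1 / 450) :=
  tameBalancedAffMidGap_depth_mono hL (h εh hε)

/-- FR_W ⇐ MID_aff,W at the same fine tolerance (prices a subset, rebates a superset). [this file] -/
theorem balancedFineLayerGapW_of_affMidGapW {ρ ρ₁ εh ε₁ θ ε g σ₁ σ₂ : ℝ} (h : BalancedAffMidGapW ρ ρ₁ ε₁ θ ε g σ₁ σ₂) :
    BalancedFineLayerGapW ρ ρ₁ εh ε₁ θ ε g σ₁ σ₂ := by
  obtain ⟨c, C, hc, h⟩ := h
  refine ⟨c, max C 0, hc, fun N y hy => ?_⟩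
  obtain ⟨u, hu, e⟩ := h N y hy
  refine ⟨u, hu, ?_⟩
  have hC : C ≤ max C 0 := le_max_left _ _
  have hC0 : 0 ≤ max C 0 := le_max_right _ _
  have h0 : (fineLayerCount ρ ρ₁ εh ε₁ θ ε g y : ℝ) ≤ affMidCount ρ ρ₁ ε₁ θ ε g y := by
    exact_mod_cast fineLayerCount_le_affMidCount y
  have h1 : (0 : ℝ) ≤ notDeepCount ρ ε g y := Nat.cast_nonneg _
  have h1' : (notDeepCount ρ ε g y : ℝ) ≤ mesoBadCount ρ ρ₁ εh θ ε g y := by exact_mod_cast notDeepCount_le_mesoBadCount y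
  have h2 : (0 : ℝ) ≤ offCount σ₁ σ₂ y := Nat.cast_nonneg _
  have h3 : (0 : ℝ) ≤ (N : ℝ) ^ (2 / 3 : ℝ) := Real.rpow_nonneg (Nat.cast_nonneg _) _
  have h4 : 0 ≤ dilGain y + shGain u y := add_nonneg (dilGain_nonneg y) (shGain_nonneg _ y)
  nlinarith [mul_le_mul_of_nonneg_right hC h1, mul_le_mul_of_nonneg_left h1' hC0, mul_le_mul_of_nonneg_left h0 hc.le,
    mul_le_mul_of_nonneg_right hC h2, mul_le_mul_of_nonneg_right hC h3, mul_le_mul_of_nonneg_right hC h4]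

/-- FR ⇐ parent: `AffMidAll ρ₁ θ ⇒ FineNonAffinity ρ₁ ε_h θ` for every `ε_h`. [this file] -/
theorem fineNonAffinity_of_affMidAll {ρ₁ εh θ : ℝ} (h : AffMidAll ρ₁ θ) : FineNonAffinity ρ₁ εh θ :=
  fun ε₁ hε₁ _ δ hδ hδ2 => balancedFineLayerGapW_of_affMidGapW (h ε₁ hε₁ δ hδ hδ2)

/-! ## §7  RECORD (literals `ρ₁ = 12`, `θ = 1/25`, `ε_h = 1/10⁵`, `L = 64`) and the slot-3 cones BY NAME through g73's `tbdsg_of_collarCut_record` -/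

/-- **M at the record from the cut**: `MR ∧ FR ⇒ AffMidAll 12 (1/25)` with
MR `= TameBalancedAffMidGap 64 12 (1/10^5) (1/25) (3/50) (1/450)`, FR `= FineNonAffinity 12 (1/10^5) (1/25)`. [this file] -/
theorem affMidAll_record_of_mesoCut (hMR : TameBalancedAffMidGap 64 12 (1 / 10 ^ 5) (1 / 25) (3 / 50) (1 / 450))
    (hFR : FineNonAffinity 12 (1 / 10 ^ 5) (1 / 25)) : AffMidAll 12 (1 / 25) :=
  affMidAll_of_mesoCut (tameBalancedAffMidGap_of_depth (by norm_num) (by norm_num) hMR) hFR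

/-- The record pieces are implied by the record parent (weaker side, PROVED). [this file] -/
theorem mesoCut_record_of_affMidAll (h : AffMidAll 12 (1 / 25)) :
    TameBalancedAffMidGap 64 12 (1 / 10 ^ 5) (1 / 25) (3 / 50) (1 / 450) ∧ FineNonAffinity 12 (1 / 10 ^ 5) (1 / 25) :=
  ⟨meso_of_affMidAll (by norm_num) (by norm_num) h, fineNonAffinity_of_affMidAll h⟩

/-- **SLOT-3 CONE OF RECORD WITH M CUT (PROVED composition)**:
`K_at⁰ ∧ R_aff ∧ CP⁺ ∧ RC ∧ RS ∧ FC ∧ N2 ∧ Z ∧ MR ∧ FR ⟹ TameBalancedDeepScaleGap (122/125) 0 4 (3/50) (1/450)` through g73's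
`tbdsg_of_collarCut_record` with its `hM` slot fed by `affMidAll_record_of_mesoCut`. [this file] -/
theorem tbdsg_of_mesoCut_record
    (hK : ∃ μ₁ μR : ℝ, 0 < μ₁ ∧ 0 < μR ∧ PureMarginStabilityAt (3 / 2000) μ₁ μR 4) (hR : AffineChartStraightening)
    (hCP : NearLightSkeletonEquilibrium (3 / 2000) 4 6 (1 / 1000) 12 (1 / 25) (1 / 2000) 4 6 320 12)
    (hRC : NearPricedCoreFloor (3 / 2000) 4 6 (1 / 1000) 12 (1 / 25) (1 / 2000) (1 / (4 * 10 ^ 7) / 4) 4 6 12)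
    (hRS : NearPricedShellFloor (3 / 2000) 4 6 (1 / 1000) 12 (1 / 25) (1 / 2000) (1 / (4 * 10 ^ 7) / 4) 4 6 12)
    (hFC : ForceContentVisible (3 / 2000) 4 6 (1 / 1000) 12 (1 / 25) (1 / 2000) 4 6)
    (h2 : NearSecondOrderFloor (3 / 2000) 4 6 (1 / 1000) 12 (1 / 25) (1 / 2000) (1 / (4 * 10 ^ 7)))
    (hZ : FarAggregatePricing 12 (1 / 25) (1 / 2000) (1 / (2 * 10 ^ 7)))
    (hMR : TameBalancedAffMidGap 64 12 (1 / 10 ^ 5) (1 / 25) (3 / 50) (1 / 450)) (hFR : FineNonAffinity 12 (1 / 10 ^ 5) (1 / 25)) :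
    TameBalancedDeepScaleGap (122 / 125) 0 4 (3 / 50) (1 / 450) :=
  tbdsg_of_collarCut_record hK hR hCP hRC hRS hFC h2 hZ (affMidAll_record_of_mesoCut hMR hFR)

/-- **The residual RDEF through the collar cut with M cut** (record shape; slot 3 = `K_at⁰ ∧ R_aff ∧ CP⁺ ∧ RC ∧ RS ∧ FC ∧ N2 ∧ Z ∧ MR ∧ FR`;
CEG, T, CE, Res the other RDEF slots). [this file] -/
theorem rdef_of_ceg_shape_mesoCut_record (hCEG : ChargedEnergyGap) (hT : TwoShellShape (1 / 100) (3 / 50) (1 / 450))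
    (hK : ∃ μ₁ μR : ℝ, 0 < μ₁ ∧ 0 < μR ∧ PureMarginStabilityAt (3 / 2000) μ₁ μR 4) (hR : AffineChartStraightening)
    (hCP : NearLightSkeletonEquilibrium (3 / 2000) 4 6 (1 / 1000) 12 (1 / 25) (1 / 2000) 4 6 320 12)
    (hRC : NearPricedCoreFloor (3 / 2000) 4 6 (1 / 1000) 12 (1 / 25) (1 / 2000) (1 / (4 * 10 ^ 7) / 4) 4 6 12)
    (hRS : NearPricedShellFloor (3 / 2000) 4 6 (1 / 1000) 12 (1 / 25) (1 / 2000) (1 / (4 * 10 ^ 7) / 4) 4 6 12)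
    (hFC : ForceContentVisible (3 / 2000) 4 6 (1 / 1000) 12 (1 / 25) (1 / 2000) 4 6)
    (h2 : NearSecondOrderFloor (3 / 2000) 4 6 (1 / 1000) 12 (1 / 25) (1 / 2000) (1 / (4 * 10 ^ 7)))
    (hZ : FarAggregatePricing 12 (1 / 25) (1 / 2000) (1 / (2 * 10 ^ 7)))
    (hMR : TameBalancedAffMidGap 64 12 (1 / 10 ^ 5) (1 / 25) (3 / 50) (1 / 450)) (hFR : FineNonAffinity 12 (1 / 10 ^ 5) (1 / 25))
    (hCE : CleanlessExcessT) (hRes : CoherentResidual 10) : RobustDefectLimitWindows :=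
  rdef_of_ceg_shape_collarCut_record hCEG hT hK hR hCP hRC hRS hFC h2 hZ (affMidAll_record_of_mesoCut hMR hFR) hCE hRes

end Summit.AtomisticToContinuum.Crystallization.Theorems.OverbindingBudgetAffineMesoCut
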